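import Literature.AlgebraicGeometry.Motives.HodgeStructureCMActionReflexField
import Literature.AlgebraicGeometry.Motives.HodgeStructureOfOrientationReflexTraceFieldFunctoriality
import Literature.AlgebraicGeometry.Motives.HodgeStructureCMDualHodgePieces
import Literature.AlgebraicGeometry.Motives.HodgeStructureOfOrientationHalfTwist
import Literature.AlgebraicGeometry.Motives.HodgeStructureCMTensorOverFieldOrientation
import Literature.AlgebraicGeometry.Motives.HodgeStructureCMEndActionProd
import Mathlib.FieldTheory.Normal.Closure
import HarnessLib

/-!
# THE REFLEX FIELD `E*` OF AN `E`-HODGE STRUCTURE IS A NUMBER FIELD INSIDE THE GALOIS CLOSURE `E^c ⊂ ℂ`, AND ITS BEHAVIOUR UNDER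
# `⊕`, duals, van Geemen's half twist and `⊗_E`: `E*(V ⊕ W) ⊆ E*(V)E*(W)`, `E*(V^∨) = E*(V)`, `E*(V{−b/2}_Θ)·E*(Θ) = E*(V)·E*(Θ)`,
# `E*(V ⊗_E W) ⊆ E*(V)E*(W)` (GGK (V.A.4), §V.B–V.C; Milne 1999 §1; Shimura §8.3)

[topic AlgebraicGeometry/Motives]

Layer `Literature/AlgebraicGeometry/Motives`, lane `lit-hodgefound` (Track 2 foundations library; seat `lit-hodgefound-p02`, gen 33, row g33-#7).
THEOREMS ONLY (no definition, no named fact; D-0026 net debt `0`).  Sequel BY NAME of g33-#3 `Motives/HodgeStructureCMActionReflexField` (`EndAction.pieceTrace`,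
`pieceMultiplicity`, `reflexField = E*`, `pieceTrace_eq_sum_pieceMultiplicity_mul`, strong case `reflexField_eq_traceField`), g33-#5
`Motives/HodgeStructureOfOrientationReflexTraceFieldFunctoriality` (`traceField_neg`, `traceField_twist_*`, `traceField_add_*`) and the tree's strong-case orientation
formulas `orientation_dual` (`Motives/HodgeStructureCMDualHodgePieces`: `Π_{V^∨} = −Π_V`), `orientation_halfTwistAction` (`Motives/HodgeStructureOfOrientationHalfTwist`:
`Π_{V{−b/2}_Θ} = Π_V{b}_Θ`), `orientation_tensorOverAction'` (`Motives/HodgeStructureCMTensorOverFieldOrientation`: `Π_{V ⊗_E W} = Π_V + Π_W`), and of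
`Motives/HodgeStructureCMEndActionProd` (`finrank_eigenPiece_prod`: the eigen-pieces of `V ⊕ W` add).  Mathlib's `IntermediateField.normalClosure ℚ E ℂ = ⨆_σ σ(E)`.

THE PRINTS.  M. Green, P. Griffiths, M. Kerr [GreenGriffithsKerr2012] (V.A.4) p. 156 (held p0156): «`F′ := ℚ({Tr^{p,q}_Π(f)})` … is equal to the fixed
field of `{σ ∈ Gal(F^c/ℚ) | …}` in `F^c`» (so `F′ ⊂ F^c`); §V.B p. 158–160 (the `{−b/2}_Θ`-twist, (V.B.1) (v)), §V.C (i) p. 161 («`Π^{p,q} := {eigenvalues of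
η(F) on V^{p,q}}`»).  J. S. Milne [Milne1999] §1 p. 13 (the reflex field of a CM Hodge structure).  G. Shimura [Shimura1998] §8.3 Prop. 28 (`K* ⊂ L`, `L`
the Galois closure).  J. Carlson, S. Müller-Stach, C. Peters [CarlsonMullerStachPeters2017] §1.2 (duals and tensor products of Hodge structures).  S. Abdulali
[Abdulali2005CMHodge] proof of Thm. 3 («`V_χ^σ ⊗ V_ψ^σ = V_{χ+ψ}^σ`»).  B. van Geemen [vanGeemen2001HalfTwists] §2.8–2.10.  P. Deligne
[Deligne1982HodgeCycles] I §5 (c) (eigenspaces of a sum).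

THE MECHANISM.  `Tr(φ(e)|V^{p,q}) = Σ_σ m_σ^{p,q} σ(e)` (g33-#3) lies in the compositum `⨆_σ σ(E) = E^c` of the conjugates of `E` in `ℂ`, a
number field; hence `E* ⊆ E^c` is a number field for EVERY `E`-Hodge structure (g33-#3 had this only for strong actions).  The eigen-pieces of
`V ⊕ W` are the sums of those of `V` and `W`, so the traces add and `E*(V ⊕ W) ⊆ E*(V)E*(W)`.  For STRONG actions `E* = (Π_φ)′` (g33-#3), the
orientations of the dual / half twist / `⊗_E` are `−Π`, `Π{b}_Θ`, `Π_V + Π_W` (tree), and g33-#5 computed `F′` of those.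

WHAT IS PROVED.  §1 (any `E`-Hodge structure, `dim V < ∞`): `pieceTrace_mem_normalClosure`, **`reflexField_le_normalClosure`** (`E* ⊆ E^c`),
**`finrank_reflexField_pos`**, `finrank_reflexField_le` (`1 ≤ [E*:ℚ] ≤ [E^c:ℚ]`: `E*` is a number field), `Orientation.typeTrace_mem_normalClosure`, **`Orientation.traceField_le_normalClosure`**
(`F′ ⊆ F^c`), `Orientation.finrank_traceField_le` (`[F′:ℚ] ≤ [F^c:ℚ]`).  §2 (any two `E`-Hodge structures of the same weight): `pieceMultiplicity_prod`
(`m^{p,q}_σ(V ⊕ W) = m^{p,q}_σ(V) + m^{p,q}_σ(W)`), `pieceTrace_prod`, **`reflexField_prod_le`** (`E*(V ⊕ W) ⊆ E*(V)·E*(W)`).  §3 (strong actions,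
`[E:ℚ] = dim V`): **`reflexField_dual`** (`E*(V^∨) = E*(V)`), **`reflexField_halfTwistAction_le`** (`E*(V{−b/2}_Θ) ⊆ E*(V)·E*(Θ)`),
`reflexField_le_reflexField_halfTwistAction_sup`, **`reflexField_halfTwistAction_sup_eq`**, **`reflexField_tensorOverAction_le`** (`E*(V ⊗_E W) ⊆
E*(V)·E*(W)`), `reflexField_le_reflexField_tensorOverAction_sup`, `reflexField_tensorOverAction_sup_eq`.

HONEST SCOPE.  §3 is for STRONG actions only (through the orientation); for the sum, the twist and `⊗_E` only the inclusions given by the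
stabiliser argument are claimed (they can be strict); `E^c` is Mathlib's `IntermediateField.normalClosure ℚ E ℂ` (the compositum of the conjugates of `E` in `ℂ`).

## References
* [GreenGriffithsKerr2012] M. Green, P. Griffiths, M. Kerr, *Mumford–Tate Groups and Domains* (2012), (V.A.4) p. 156, §V.B pp. 158–160, §V.C (i) p. 161.
* [Milne1999] J. S. Milne, *Lefschetz motives and the Tate conjecture*, Compositio Math. 117 (1999), §1 (p. 13).
* [Shimura1998] G. Shimura, *Abelian Varieties with Complex Multiplication and Modular Functions* (1998), §8.3 Prop. 28.
* [CarlsonMullerStachPeters2017] J. Carlson, S. Müller-Stach, C. Peters, *Period Mappings and Period Domains*, 2nd ed. (2017), §1.2.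
* [Abdulali2005CMHodge] S. Abdulali, *Hodge structures of CM-type*, J. Ramanujan Math. Soc. 20 (2005), proof of Thm. 3.
* [vanGeemen2001HalfTwists] B. van Geemen, *Half twists of Hodge structures of CM-type*, J. Math. Soc. Japan 53 (2001), §2.8–2.10.
* [Deligne1982HodgeCycles] P. Deligne, *Hodge cycles on abelian varieties*, LNM 900 (1982), I §5 (c).

## Provenance
Lane `lit-hodgefound` (Hodge path, Track 2), prover seat `lit-hodgefound-p02` (generation 33), self-proposed row g33-#7.
-/

noncomputable section

open scoped TensorProduct Classical
open Module NumberField Cardinal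

namespace Literature.AlgebraicGeometry.Motives

namespace HodgeStructure

open Literature.NumberTheory.ComplexMultiplication

/-! ### §1 `E* ⊆ E^c` is a number field, for every `E`-Hodge structure -/

namespace EndAction

section General

universe u v

variable {V : Type u} [AddCommGroup V] [Module ℚ V] [Module.Finite ℚ V] {n : ℤ} {E : Type v} [Field E] [NumberField E]
  {H : HodgeStructure V n} (A : EndAction H E)

/-- **`Tr(φ(e)|V^{p,q}) ∈ E^c`**, the compositum `⨆_σ σ(E)` of the conjugates of `E` in `ℂ` (the trace is `Σ_σ m_σ^{p,q} σ(e)`, g33-#3).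
[cite: GreenGriffithsKerr2012, (V.A.4) p. 156, §V.C (i) p. 161] [cite: Shimura1998, §8.3 Prop. 28] -/
theorem pieceTrace_mem_normalClosure (p q : ℤ) (e : E) : A.pieceTrace p q e ∈ IntermediateField.normalClosure ℚ E ℂ := by
  rw [A.pieceTrace_eq_sum_pieceMultiplicity_mul p q e]
  refine sum_mem fun σ _ => mul_mem (by exact_mod_cast natCast_mem (IntermediateField.normalClosure ℚ E ℂ) (A.pieceMultiplicity σ p q)) ?_
  exact σ.toRatAlgHom.fieldRange_le_normalClosure ⟨e, rfl⟩

/-- **`E* ⊆ E^c`: the reflex field of an `E`-Hodge structure lies in the Galois closure of `E` in `ℂ`** («the fixed field of `{σ ∈ Gal(F^c/ℚ) | …}` in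
`F^c`»). [cite: GreenGriffithsKerr2012, (V.A.4) p. 156] [cite: Shimura1998, §8.3 Prop. 28] [cite: Milne1999, §1 (p. 13)] -/
theorem reflexField_le_normalClosure : A.reflexField ≤ IntermediateField.normalClosure ℚ E ℂ := by
  rw [reflexField_eq_adjoin, IntermediateField.adjoin_le_iff]
  rintro _ ⟨t, rfl⟩
  exact A.pieceTrace_mem_normalClosure _ _ _

omit [Module.Finite ℚ V] A in
/-- A subfield of a finite extension, inside `ℂ`, is finite (bookkeeping). [folklore] -/
private theorem finiteDimensional_of_le' {F F' : IntermediateField ℚ ℂ} [FiniteDimensional ℚ F] (h : F' ≤ F) : FiniteDimensional ℚ F' :=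
  FiniteDimensional.of_injective (IntermediateField.inclusion h).toLinearMap (IntermediateField.inclusion_injective h)

/-- **`E*` IS A NUMBER FIELD for every `E`-Hodge structure on a finite-dimensional `V`: `1 ≤ [E* : ℚ] ≤ [E^c : ℚ] < ∞`** (g33-#3's
`finiteDimensional_reflexField` needed a strong action; finite-dimensionality is `Module.finite_of_finrank_pos` applied to this).
[cite: Milne1999, §1 (p. 13)] [cite: GreenGriffithsKerr2012, (V.A.4) p. 156] -/
theorem finrank_reflexField_pos : 0 < finrank ℚ A.reflexField :=
  haveI := finiteDimensional_of_le' A.reflexField_le_normalClosure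
  Module.finrank_pos

/-- `[E* : ℚ] ≤ [E^c : ℚ]`. [cite: GreenGriffithsKerr2012, (V.A.4) p. 156] [cite: Shimura1998, §8.3 Prop. 28] -/
theorem finrank_reflexField_le : finrank ℚ A.reflexField ≤ finrank ℚ (IntermediateField.normalClosure ℚ E ℂ) :=
  IntermediateField.finrank_le_of_le_right A.reflexField_le_normalClosure

end General

end EndAction

namespace Orientation

variable {K : Type} [Field K] [NumberField K] {n : ℤ} (Λ : Orientation K n)

/-- `Tr^p_Π(x) = Σ_{θ ∈ Π^{p,·}} θ(x) ∈ F^c`. [cite: GreenGriffithsKerr2012, (V.A.4) p. 156] -/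
theorem typeTrace_mem_normalClosure (p : ℤ) (x : K) : Λ.typeTrace p x ∈ IntermediateField.normalClosure ℚ K ℂ := by
  rw [typeTrace_apply]
  exact sum_mem fun θ _ => θ.toRatAlgHom.fieldRange_le_normalClosure ⟨x, rfl⟩

/-- **`F′ ⊆ F^c`**: the reflex field of an `n`-orientation of `F` lies in the Galois closure of `F` in `ℂ` (g33-#1 `traceField_le_fieldRange` for a chosen
Galois `L ⊇ F`; here Mathlib's `IntermediateField.normalClosure ℚ F ℂ`). [cite: GreenGriffithsKerr2012, (V.A.4) p. 156] [cite: Shimura1998, §8.3 Prop. 28] -/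
theorem traceField_le_normalClosure : Λ.traceField ≤ IntermediateField.normalClosure ℚ K ℂ := by
  rw [traceField_eq_adjoin, IntermediateField.adjoin_le_iff]
  rintro _ ⟨px, rfl⟩
  exact Λ.typeTrace_mem_normalClosure _ _

/-- `[F′ : ℚ] ≤ [F^c : ℚ]`. [cite: GreenGriffithsKerr2012, (V.A.4) p. 156] -/
theorem finrank_traceField_le : finrank ℚ Λ.traceField ≤ finrank ℚ (IntermediateField.normalClosure ℚ K ℂ) :=
  IntermediateField.finrank_le_of_le_right Λ.traceField_le_normalClosure

end Orientation

/-! ### §2 Direct sums: `E*(V ⊕ W) ⊆ E*(V)·E*(W)` -/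

namespace EndAction

section Prod

universe u v w

variable {V : Type u} [AddCommGroup V] [Module ℚ V] [Module.Finite ℚ V] {W : Type v} [AddCommGroup W] [Module ℚ W] [Module.Finite ℚ W]
  {n : ℤ} {E : Type w} [Field E] [NumberField E] {H₁ : HodgeStructure V n} {H₂ : HodgeStructure W n}
  (A₁ : EndAction H₁ E) (A₂ : EndAction H₂ E)

/-- **`m^{p,q}_σ(V ⊕ W) = m^{p,q}_σ(V) + m^{p,q}_σ(W)`** (the eigen-pieces add, `finrank_eigenPiece_prod`). [cite: Deligne1982HodgeCycles, I §5 (c)]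
[cite: CarlsonMullerStachPeters2017, §1.2] -/
theorem pieceMultiplicity_prod (σ : E →+* ℂ) (p q : ℤ) :
    (A₁.prod A₂).pieceMultiplicity σ p q = A₁.pieceMultiplicity σ p q + A₂.pieceMultiplicity σ p q :=
  finrank_eigenPiece_prod A₁ A₂ σ p q

/-- **`Tr(φ(e)|(V ⊕ W)^{p,q}) = Tr(φ(e)|V^{p,q}) + Tr(φ(e)|W^{p,q})`.** [cite: CarlsonMullerStachPeters2017, §1.2] [cite: GreenGriffithsKerr2012, §V.C (i) p. 161] -/
theorem pieceTrace_prod (p q : ℤ) (e : E) : (A₁.prod A₂).pieceTrace p q e = A₁.pieceTrace p q e + A₂.pieceTrace p q e := by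
  rw [pieceTrace_eq_sum_pieceMultiplicity_mul, pieceTrace_eq_sum_pieceMultiplicity_mul, pieceTrace_eq_sum_pieceMultiplicity_mul,
    ← Finset.sum_add_distrib]
  exact Finset.sum_congr rfl fun σ _ => by rw [pieceMultiplicity_prod, Nat.cast_add, add_mul]

/-- **`E*(V ⊕ W) ⊆ E*(V)·E*(W)`**: the reflex field of a direct sum of `E`-Hodge structures lies in the compositum of the reflex fields.
[cite: Milne1999, §1 (p. 13)] [cite: GreenGriffithsKerr2012, (V.A.4) p. 156, §V.C (i) p. 161] -/
theorem reflexField_prod_le : (A₁.prod A₂).reflexField ≤ A₁.reflexField ⊔ A₂.reflexField := by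
  rw [reflexField_eq_adjoin, IntermediateField.adjoin_le_iff]
  rintro _ ⟨t, rfl⟩
  change (A₁.prod A₂).pieceTrace t.1.1 t.1.2 t.2 ∈ A₁.reflexField ⊔ A₂.reflexField
  rw [pieceTrace_prod]
  exact add_mem (le_sup_left (b := A₂.reflexField) (A₁.pieceTrace_mem_reflexField _ _ _))
    (le_sup_right (a := A₁.reflexField) (A₂.pieceTrace_mem_reflexField _ _ _))

end Prod

/-! ### §3 Strong actions: duals, half twists, tensor products over `E` -/

section Strong

universe u

variable {V W : Type u} [AddCommGroup V] [Module ℚ V] [Module.Finite ℚ V] [AddCommGroup W] [Module ℚ W] [Module.Finite ℚ W]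
  {n m : ℤ} {E : Type} [Field E] [NumberField E] {H : HodgeStructure V n} {H₂ : HodgeStructure W m}
  (A : EndAction H E) (B : EndAction H₂ E)

/-- **`E*(V^∨) = E*(V)`**: the dual of a strong CM-Hodge structure has the same reflex field (`Π_{V^∨} = −Π_V` and `(−Π)′ = Π′`).
[cite: CarlsonMullerStachPeters2017, §1.2] [cite: GreenGriffithsKerr2012, §V.A p. 154, (V.A.4) p. 156, §V.C (i) p. 161] -/
theorem reflexField_dual [HodgeTensorFacts.{u, u}] (hS : finrank ℚ E = finrank ℚ V) : A.dual.reflexField = A.reflexField := by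
  rw [A.dual.reflexField_eq_traceField (hS.trans Subspace.dual_finrank_eq.symm), A.orientation_dual hS, Orientation.traceField_neg,
    ← A.reflexField_eq_traceField hS]

/-- **`E*(V{−b/2}_Θ) ⊆ E*(V)·E*(Θ)`** for van Geemen's half twist of a strong CM-Hodge structure by a CM type `Θ` of `E` (`E*(Θ) = ℚ(tr_Θ)` Shimura's reflex
field; `Π_{V{−b/2}_Θ} = Π_V{b}_Θ` and g33-#5). [cite: GreenGriffithsKerr2012, §V.B pp. 158–160, (V.A.4) p. 156] [cite: vanGeemen2001HalfTwists, §2.8–2.10] -/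
theorem reflexField_halfTwistAction_le (hS : finrank ℚ E = finrank ℚ V) (Θ : CMType E) (b : ℤ) :
    (A.halfTwistAction Θ b).reflexField ≤ A.reflexField ⊔ traceField Θ := by
  rw [(A.halfTwistAction Θ b).reflexField_eq_traceField hS, A.orientation_halfTwistAction hS Θ b, A.reflexField_eq_traceField hS,
    ← Orientation.traceField_ofCMType Θ]
  exact (A.orientation hS).traceField_twist_le Θ b

/-- `E*(V) ⊆ E*(V{−b/2}_Θ)·E*(Θ)` (`V = V{−b/2}_Θ{b/2}_Θ`). [cite: GreenGriffithsKerr2012, §V.B p. 159, (V.A.4) p. 156] [cite: vanGeemen2001HalfTwists, §2.8–2.10] -/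
theorem reflexField_le_reflexField_halfTwistAction_sup (hS : finrank ℚ E = finrank ℚ V) (Θ : CMType E) (b : ℤ) :
    A.reflexField ≤ (A.halfTwistAction Θ b).reflexField ⊔ traceField Θ := by
  rw [(A.halfTwistAction Θ b).reflexField_eq_traceField hS, A.orientation_halfTwistAction hS Θ b, A.reflexField_eq_traceField hS,
    ← Orientation.traceField_ofCMType Θ]
  exact (A.orientation hS).traceField_le_traceField_twist_sup Θ b

/-- **`E*(V{−b/2}_Θ)·E*(Θ) = E*(V)·E*(Θ)`**: over the reflex field of the twisting type, a strong CM-Hodge structure and its half twists have the same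
reflex field. [cite: GreenGriffithsKerr2012, §V.B pp. 158–160, (V.A.4) p. 156] [cite: vanGeemen2001HalfTwists, §2.8–2.10] -/
theorem reflexField_halfTwistAction_sup_eq (hS : finrank ℚ E = finrank ℚ V) (Θ : CMType E) (b : ℤ) :
    (A.halfTwistAction Θ b).reflexField ⊔ traceField Θ = A.reflexField ⊔ traceField Θ :=
  le_antisymm (sup_le (A.reflexField_halfTwistAction_le hS Θ b) le_sup_right)
    (sup_le (A.reflexField_le_reflexField_halfTwistAction_sup hS Θ b) le_sup_right)

variable [HodgeTensorFacts.{u, u}]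

/-- **`E*(V ⊗_E W) ⊆ E*(V)·E*(W)`** for strong CM-Hodge structures with CM by the same `E` (`Π_{V ⊗_E W} = Π_V + Π_W` and g33-#5 `traceField_add_le`).
[cite: Abdulali2005CMHodge, proof of Thm. 3] [cite: GreenGriffithsKerr2012, §V.B (V.B.1) (ii) p. 158, (V.A.4) p. 156] [cite: CarlsonMullerStachPeters2017, §1.2] -/
theorem reflexField_tensorOverAction_le (hS : finrank ℚ E = finrank ℚ V) (hS' : finrank ℚ E = finrank ℚ W) :
    (tensorOverAction A B).reflexField ≤ A.reflexField ⊔ B.reflexField := by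
  rw [(tensorOverAction A B).reflexField_eq_traceField (A.finrank_eq_finrank_tensorOver B hS hS'), A.orientation_tensorOverAction' B hS hS',
    A.reflexField_eq_traceField hS, B.reflexField_eq_traceField hS']
  exact (A.orientation hS).traceField_add_le (B.orientation hS')

/-- `E*(V) ⊆ E*(V ⊗_E W)·E*(W)`. [cite: Abdulali2005CMHodge, proof of Thm. 3] [cite: GreenGriffithsKerr2012, (V.A.4) p. 156] -/
theorem reflexField_le_reflexField_tensorOverAction_sup (hS : finrank ℚ E = finrank ℚ V) (hS' : finrank ℚ E = finrank ℚ W) :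
    A.reflexField ≤ (tensorOverAction A B).reflexField ⊔ B.reflexField := by
  rw [(tensorOverAction A B).reflexField_eq_traceField (A.finrank_eq_finrank_tensorOver B hS hS'), A.orientation_tensorOverAction' B hS hS',
    A.reflexField_eq_traceField hS, B.reflexField_eq_traceField hS']
  exact (A.orientation hS).traceField_le_traceField_add_sup (B.orientation hS')

/-- `E*(V ⊗_E W)·E*(W) = E*(V)·E*(W)`. [cite: Abdulali2005CMHodge, proof of Thm. 3] [cite: GreenGriffithsKerr2012, (V.A.4) p. 156] -/
theorem reflexField_tensorOverAction_sup_eq (hS : finrank ℚ E = finrank ℚ V) (hS' : finrank ℚ E = finrank ℚ W) :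
    (tensorOverAction A B).reflexField ⊔ B.reflexField = A.reflexField ⊔ B.reflexField :=
  le_antisymm (sup_le (A.reflexField_tensorOverAction_le B hS hS') le_sup_right)
    (sup_le (A.reflexField_le_reflexField_tensorOverAction_sup B hS hS') le_sup_right)

end Strong

end EndAction

end HodgeStructure

end Literature.AlgebraicGeometry.Motives
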